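import Literature.Barriers.CriticalPhenomena.LaceExpansionIsingGreenUniform
import Literature.Probability.LatticeModels.UniformStepWalk
import Mathlib.Analysis.PSeries
import HarnessLib

/-!
# Liu–Slade's Proposition 1.2, (1.10), proved: the `L`-uniform bound
# `S_1(x) ≤ δ_{0,x} + K_S L^{-(2-ε)} ⟦x⟧^{-(d-2)}` on the spread-out Green function

Barrier catalogue `Literature/Barriers/CriticalPhenomena/` (D-0021), a companion file of the
barrier `LaceExpansionIsingAboveFour` and of `LaceExpansionIsingDeconvolution.lean`, whose named
fact `LiuSlade2026_prop12_greenBound` — Liu–Slade 2026, Proposition 1.2, second display (1.10):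
"there is a constant `K_S = K_S(ε)` such that `S_1(x) ≤ δ_{0,x} + K_S L^{-(2-ε)} ⟦x⟧^{-(d-2)}`
(`x ∈ ℤ^d`)", `d > 2`, `L ≥ L₀`, for the step distribution `D(x) = 1{0 < ‖x‖_∞ ≤ L}/N_L` of
the uniformly spread-out model (`soStep`) and `S_1 = Σ_n D^{*n}` (`soGreen d L 1`) — is
DISCHARGED here: `LiuSlade2026_prop12_greenBound_holds`. In the source this is proved (App. A)
by the weak-derivative Fourier method of Liu–Slade 2024; we give instead an elementary proof
of the stronger `ε = 0` bound `S_1(x) ≤ δ_{0,x} + K L^{-2} ⟦x⟧^{-(d-2)}` (`L ≥ 1`), which implies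
the printed statement for every `ε > 0` with `K_S = K` independent of `ε` and `L₀ = 1`.
(The sibling `LaceExpansionIsingGreenUniform.lean` proves, by the printed Fourier route, the
`|x| ≤ L` half `S_1(x) ≤ δ_{0,x} + C_d L^{-d}` and the infrared bound; the present file is
independent of that analysis and uses from it only `N_L + 1 = (2L+1)^d`.)

## The proof

* Puncture removal (`soGreen_one_le_cubeGreen`). Let `U` be the uniform
  distribution on the FULL cube `{‖y‖_∞ ≤ L}` (`cubeStep`), so that
  `U = p₀ δ + (1 - p₀) D` with `p₀ = (2L+1)^{-d}` (`cubeStep_eq_delta0_add_soStep`, using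
  `N_L = (2L+1)^d - 1`, `soCount_add_one` of `…GreenUniform.lean`). Its Green function `G_U = Σ_m U^{*m}` satisfies
  `G_U = δ + G_U * U = δ + p₀ G_U + (1-p₀) G_U * D`, hence `G_U = δ/(1-p₀) + G_U * D ≥ δ + G_U * D`
  (`cubeGreen_supersolution`): `G_U` is a supersolution of the equation
  `S = δ + S * D` of which `S_1 = Σ_n D^{*n}` is the minimal nonnegative solution, so
  `Σ_{n<N} D^{*n} ≤ G_U` by induction on `N` and `S_1 ≤ G_U`.
* Tensorisation (`convPow_cubeStep`): `U^{*m}(x) = Π_j u_L^{*m}(x_j)` with `u_L` the uniform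
  distribution on `{-L,…,L} ⊂ ℤ`, whose `L`-uniform Gaussian bound
  `u_L^{*m}(y) ≤ (20/(L√m)) e^{-y²/(8mL²)}` is
  `Literature.Probability.LatticeModels.UniformStep.coeff_uniformStep_pow_le_gauss`; hence
  `U^{*m}(x) ≤ (20/(L√m))^d e^{-|x|²/(8mL²)}` (`convPow_cubeStep_le_gauss`).
* Summation (`tsum_rpow_inv_mul_exp_le`): `Σ_{m≥1} m^{-s} e^{-a/m} ≤ C_s (1+a)^{1-s}` for `s > 1`,
  `a ≥ 0` (head `m ≤ a` by `e^{-y} ≤ k!/yᵏ`, tail by the telescoping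
  `(s-1)(m+1)^{-s} ≤ m^{1-s} - (m+1)^{1-s}`), applied with `s = d/2`, `a = |x|²/(8L²)`:
  `S_1(x) ≤ δ_{0,x} + 20^d C L^{-d}(1 + |x|²/(8L²))^{1-d/2}`
  `≤ δ_{0,x} + 20^d C 8^{d/2-1} L^{-2} ⟦x⟧^{2-d}`.

## References

* Y. Liu, G. Slade, *Gaussian deconvolution and the lace expansion for spread-out models*,
  Ann. Inst. H. Poincaré Probab. Statist. (2026), arXiv:2310.07640: Definition 1.1,
  §1.2.1 (1.6)–(1.8), Proposition 1.2 with (1.9)–(1.10) ("the uniformity in `L` needs care, is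
  not standard, and is required for our results"), Appendix A [LiuSlade2026]; T. Hara,
  R. van der Hofstad, G. Slade, Ann. Probab. 31 (2003), Prop. 1.7 (the original `L`-uniform
  bounds). (Equation numbers are those of the arXiv version held in the literature store.)
* A. Sakai, Comm. Math. Phys. 272 (2007), §1.2, (1.15) and (1.19) (`D`, `N_L`, `S_1`)
  [Sakai2007].
-/

noncomputable section

namespace Literature.Barriers.CriticalPhenomena.SpreadOutIsing

open Finset Literature.Probability.LatticeModels Literature.Probability.LatticeModels.UniformStep
open scoped BigOperators

variable {d L : ℕ}

/-! ## Part G. The full-cube walk and the removal of the puncture -/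

/-- The uniform distribution on the FULL cube `{‖x‖_∞ ≤ L}` (origin included), written as the
product of its coordinate marginals, the uniform distributions `u_L` on `{-L,…,L}`:
`U(x) = Π_j u_L(x_j) = (2L+1)^{-d} 1{‖x‖_∞ ≤ L}` (Liu–Slade's example after Def. 1.1: "if
`v(x) = 2^{-d} 1{‖x‖_∞ ≤ 1}`, then `D` is the uniform distribution on `[-L,L]^d ∩ ℤ^d`").
[cite: LiuSlade2026, Definition 1.1 and the example following it] -/
def cubeStep (d L : ℕ) (x : Site d) : ℝ := ∏ j, (uniformStep L).coeff (x j)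

/-- `U(x) = (2L+1)^{-d} 1{‖x‖_∞ ≤ L}`. [cite: LiuSlade2026, Definition 1.1 (example)] -/
theorem cubeStep_eq (x : Site d) :
    cubeStep d L x = if ∀ j, |x j| ≤ L then (((2 * L + 1 : ℝ)) ^ d)⁻¹ else 0 := by
  unfold cubeStep
  simp_rw [coeff_uniformStep]
  split_ifs with h
  · rw [Finset.prod_congr rfl fun j _ => if_pos (h j), Finset.prod_const, Finset.card_univ,
      Fintype.card_fin, inv_pow]
  · push Not at h
    obtain ⟨j, hj⟩ := h
    exact Finset.prod_eq_zero (Finset.mem_univ j) (if_neg (not_le.2 hj))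

/-- `U ≥ 0`. [folklore] -/
theorem cubeStep_nonneg (x : Site d) : 0 ≤ cubeStep d L x :=
  Finset.prod_nonneg fun j _ => nonneg_uniformStep L (x j)

/-- **The puncture**: `U = p₀ δ + (1 - p₀) D` pointwise, `p₀ = (2L+1)^{-d}` (`d, L ≥ 1`) — the
uniform distribution on the cube is the mixture of the point mass at the origin and the uniform
distribution `D` on the punctured cube. [cite: Sakai2007, §1.2, (1.15) (D(x) = 1{0<‖x‖∞≤L}/N_L)] -/
theorem cubeStep_eq_delta0_add_soStep (hd : 1 ≤ d) (hL : 1 ≤ L) (z : Site d) :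
    cubeStep d L z = (((2 * L + 1 : ℝ)) ^ d)⁻¹ * delta0 z +
      (1 - (((2 * L + 1 : ℝ)) ^ d)⁻¹) * soStep d L z := by
  set M : ℝ := (2 * L + 1 : ℝ) ^ d with hM
  have h2L : (1 : ℝ) < 2 * L + 1 := by
    have : (1 : ℝ) ≤ L := by exact_mod_cast hL
    linarith
  have hM1 : 1 < M := one_lt_pow₀ h2L (by omega)
  have hN : (soCount d L : ℝ) = M - 1 := eq_sub_of_add_eq (soCount_add_one d L)
  rw [cubeStep_eq]
  by_cases hz : z = 0
  · subst hz
    rw [if_pos fun j => by simp, delta0_zero, mul_one,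
      soStep_of_not_adj (SimpleGraph.irrefl _), mul_zero, add_zero]
  · rw [delta0_of_ne_zero hz, mul_zero, zero_add]
    unfold soStep
    by_cases hadj : (spreadOutGraph d L).Adj 0 z
    · have hcube : ∀ j, |z j| ≤ L := fun j => by
        have := ((spreadOutGraph_adj_iff d L 0 z).1 hadj).2 j
        simpa using this
      rw [if_pos hcube, if_pos hadj, hN]
      have hM0 : M - 1 ≠ 0 := by linarith
      field_simp
      ring
    · rw [if_neg hadj, if_neg, mul_zero]
      intro hcube
      apply hadj
      rw [spreadOutGraph_adj_iff]
      exact ⟨Ne.symm hz, fun i => by simpa using hcube i⟩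

/-- `(f * D)(w) = Σ_{u ∼ w} f(u) D(w - u)` — a finite sum, for every `f`. [folklore] -/
theorem latticeConv_soStep_eq_sum_neighborFinset (f : Site d → ℝ) (w : Site d) :
    latticeConv f (soStep d L) w =
      ∑ u ∈ (spreadOutGraph d L).neighborFinset w, f u * soStep d L (w - u) := by
  unfold latticeConv
  refine tsum_eq_sum fun u hu => ?_
  rw [soStep_sub, if_neg, mul_zero]
  exact fun h => hu ((SimpleGraph.mem_neighborFinset _ _ _).2 h.symm)

/-- `(f * U)(w) = Σ_{u ∈ w + [-L,L]^d} f(u) U(w - u)` — a finite sum, for every `f`. [folklore] -/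
theorem latticeConv_cubeStep_eq_sum (f : Site d → ℝ) (w : Site d) :
    latticeConv f (cubeStep d L) w =
      ∑ u ∈ Fintype.piFinset (fun j => Icc (w j - L) (w j + L)), f u * cubeStep d L (w - u) := by
  unfold latticeConv
  refine tsum_eq_sum fun u hu => ?_
  rw [cubeStep_eq, if_neg, mul_zero]
  intro h
  apply hu
  rw [Fintype.mem_piFinset]
  intro j
  have := h j
  rw [Pi.sub_apply, abs_le] at this
  rw [Finset.mem_Icc]
  constructor <;> linarith [this.1, this.2]

/-- `(f * δ)(w) = f(w)`. [folklore] -/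
theorem latticeConv_delta0 (f : Site d → ℝ) (w : Site d) : latticeConv f delta0 w = f w := by
  unfold latticeConv
  rw [tsum_eq_single w]
  · rw [sub_self, delta0_zero, mul_one]
  · intro u hu
    rw [delta0_of_ne_zero (sub_ne_zero.2 (Ne.symm hu)), mul_zero]

/-- **Linearity of the puncture decomposition under convolution**:
`f * U = p₀ f + (1 - p₀) f * D` pointwise (`d, L ≥ 1`). [folklore] -/
theorem latticeConv_cubeStep (hd : 1 ≤ d) (hL : 1 ≤ L) (f : Site d → ℝ) (w : Site d) :
    latticeConv f (cubeStep d L) w = (((2 * L + 1 : ℝ)) ^ d)⁻¹ * f w +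
      (1 - (((2 * L + 1 : ℝ)) ^ d)⁻¹) * latticeConv f (soStep d L) w := by
  set p₀ : ℝ := (((2 * L + 1 : ℝ)) ^ d)⁻¹ with hp₀
  have h1 : ∀ u, f u * cubeStep d L (w - u) =
      p₀ * (f u * delta0 (w - u)) + (1 - p₀) * (f u * soStep d L (w - u)) := fun u => by
    rw [cubeStep_eq_delta0_add_soStep hd hL]
    ring
  have hs1 : Summable fun u => p₀ * (f u * delta0 (w - u)) := by
    refine summable_of_ne_finset_zero (s := {w}) fun u hu => ?_
    rw [Finset.mem_singleton] at hu
    rw [delta0_of_ne_zero (sub_ne_zero.2 (Ne.symm hu)), mul_zero, mul_zero]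
  have hs2 : Summable fun u => (1 - p₀) * (f u * soStep d L (w - u)) := by
    refine summable_of_ne_finset_zero (s := (spreadOutGraph d L).neighborFinset w) fun u hu => ?_
    rw [soStep_sub, if_neg, mul_zero, mul_zero]
    exact fun h => hu ((SimpleGraph.mem_neighborFinset _ _ _).2 h.symm)
  calc latticeConv f (cubeStep d L) w
      = ∑' u, (p₀ * (f u * delta0 (w - u)) + (1 - p₀) * (f u * soStep d L (w - u))) :=
        tsum_congr h1
    _ = p₀ * ∑' u, f u * delta0 (w - u) + (1 - p₀) * ∑' u, f u * soStep d L (w - u) := by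
        rw [hs1.tsum_add hs2, tsum_mul_left, tsum_mul_left]
    _ = p₀ * f w + (1 - p₀) * latticeConv f (soStep d L) w := by
        rw [← latticeConv_delta0 f w]
        rfl

/-! ## Part H. Tensorisation and the Gaussian bound for the full-cube walk -/

/-- **Tensorisation**: the `n`-step distribution of the full-cube walk is the product of the
`n`-step distributions of its (independent) coordinate walks, `U^{*n}(x) = Π_j u_L^{*n}(x_j)`.
[folklore] -/
theorem convPow_cubeStep (n : ℕ) (x : Site d) :
    convPow (cubeStep d L) n x = ∏ j, ((uniformStep L) ^ n).coeff (x j) := by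
  induction n generalizing x with
  | zero =>
    simp only [convPow, pow_zero, delta0, AddMonoidAlgebra.one_def, AddMonoidAlgebra.coeff_single,
      Finsupp.single_apply]
    rw [Finset.prod_boole]
    simp only [Finset.mem_univ, forall_const]
    congr 1
    apply propext
    constructor
    · intro h j
      rw [h]
      rfl
    · intro h
      funext j
      exact (h j).symm
  | succ n ih =>
    show latticeConv (convPow (cubeStep d L) n) (cubeStep d L) x = _
    rw [latticeConv_cubeStep_eq_sum]
    simp_rw [ih]
    have hfac : ∀ j, ((uniformStep L) ^ (n + 1)).coeff (x j) =
        ∑ m ∈ Icc (x j - L) (x j + L),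
          ((uniformStep L) ^ n).coeff m * (uniformStep L).coeff (x j - m) := fun j => by
      rw [pow_succ, sum_Icc_coeff_mul_coeff_uniformStep]
    simp_rw [hfac]
    rw [Finset.prod_univ_sum]
    refine Finset.sum_congr rfl fun u _ => ?_
    unfold cubeStep
    rw [← Finset.prod_mul_distrib]
    rfl

/-- `U^{*n} ≥ 0`. [folklore] -/
theorem convPow_cubeStep_nonneg (n : ℕ) (x : Site d) : 0 ≤ convPow (cubeStep d L) n x := by
  rw [convPow_cubeStep]
  exact Finset.prod_nonneg fun _ _ => (nonneg_uniformStep L).pow n _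

/-- **The `L`-uniform Gaussian bound for the full-cube walk**: for `L, n ≥ 1` and all `x`,
`U^{*n}(x) ≤ (20/(L√n))^d exp(-|x|²/(8nL²))`. [folklore] -/
theorem convPow_cubeStep_le_gauss (hL : 1 ≤ L) {n : ℕ} (hn : 1 ≤ n) (x : Site d) :
    convPow (cubeStep d L) n x ≤
      (20 / (L * Real.sqrt n)) ^ d * Real.exp (-(euclidNorm x ^ 2 / (8 * n * L ^ 2))) := by
  rw [convPow_cubeStep]
  calc ∏ j, ((uniformStep L) ^ n).coeff (x j)
      ≤ ∏ j, (20 / (L * Real.sqrt n) * Real.exp (-(((x j : ℤ) : ℝ) ^ 2 / (8 * n * L ^ 2)))) :=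
        Finset.prod_le_prod (fun _ _ => (nonneg_uniformStep L).pow n _)
          fun j _ => coeff_uniformStep_pow_le_gauss hL hn (x j)
    _ = (20 / (L * Real.sqrt n)) ^ d *
          ∏ j, Real.exp (-(((x j : ℤ) : ℝ) ^ 2 / (8 * n * L ^ 2))) := by
        rw [Finset.prod_mul_distrib, Finset.prod_const, Finset.card_univ, Fintype.card_fin]
    _ = _ := by
        rw [← Real.exp_sum, euclidNorm_sq, Finset.sum_neg_distrib, ← Finset.sum_div]

/-- The prefactor in closed form: `(20/(L√m))^d = (20/L)^d m^{-d/2}`. [folklore] -/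
theorem gauss_prefactor_eq (L : ℕ) (d : ℕ) {m : ℝ} (hm : 0 ≤ m) :
    (20 / ((L : ℝ) * Real.sqrt m)) ^ d = (20 / (L : ℝ)) ^ d * (m ^ ((d : ℝ) / 2))⁻¹ := by
  rw [div_mul_eq_div_div, div_pow, div_eq_mul_inv]
  congr 2
  rw [Real.sqrt_eq_rpow, ← Real.rpow_natCast, ← Real.rpow_mul hm]
  congr 1
  ring

/-- The Gaussian bound in the form used for summation over `n`:
`U^{*(n+1)}(x) ≤ (20/L)^d (n+1)^{-d/2} exp(-(|x|²/(8L²))/(n+1))`. [folklore] -/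
theorem convPow_cubeStep_succ_le (hL : 1 ≤ L) (n : ℕ) (x : Site d) :
    convPow (cubeStep d L) (n + 1) x ≤ (20 / (L : ℝ)) ^ d *
      ((((n : ℝ) + 1) ^ ((d : ℝ) / 2))⁻¹ *
        Real.exp (-(euclidNorm x ^ 2 / (8 * L ^ 2) / ((n : ℝ) + 1)))) := by
  have h := convPow_cubeStep_le_gauss hL (Nat.succ_pos n) x
  rw [Nat.cast_succ, gauss_prefactor_eq L d (by positivity), mul_assoc] at h
  convert h using 4
  rw [div_div]
  congr 1
  ring

/-- The Green function of the full-cube walk converges in `d ≥ 3` (`L ≥ 1`): its terms are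
`O((20/L)^d n^{-d/2})`. [folklore] -/
theorem summable_convPow_cubeStep (hd : 3 ≤ d) (hL : 1 ≤ L) (x : Site d) :
    Summable fun n => convPow (cubeStep d L) n x := by
  refine (summable_nat_add_iff 1).1 ?_
  have hd2 : 1 < (d : ℝ) / 2 := by
    have : (3 : ℝ) ≤ d := by exact_mod_cast hd
    linarith
  have hbound : ∀ n : ℕ, convPow (cubeStep d L) (n + 1) x ≤
      (20 / (L : ℝ)) ^ d * (((n : ℝ) + 1) ^ ((d : ℝ) / 2))⁻¹ := fun n => by
    refine (convPow_cubeStep_succ_le hL n x).trans ?_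
    refine mul_le_mul_of_nonneg_left ?_ (by positivity)
    refine mul_le_of_le_one_right (by positivity) (Real.exp_le_one_iff.2 ?_)
    rw [neg_nonpos]
    positivity
  refine Summable.of_nonneg_of_le (fun n => convPow_cubeStep_nonneg _ _) hbound ?_
  refine Summable.mul_left _ ?_
  have := (summable_nat_add_iff 1).2 (Real.summable_nat_rpow_inv.2 hd2)
  simpa [Nat.cast_add, Nat.cast_one] using this


/-! ## Part I. `S_1 ≤ G_U`: the punctured walk's Green function is dominated by the full-cube
walk's (supersolution comparison) -/

/-- The Green function `G_U = Σ_m U^{*m}` of the full-cube walk (`d ≥ 3`, `L ≥ 1`; the series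
converges by `summable_convPow_cubeStep`). [folklore] -/
def cubeGreen (d L : ℕ) (x : Site d) : ℝ := ∑' n, convPow (cubeStep d L) n x

/-- `G_U ≥ 0`. [folklore] -/
theorem cubeGreen_nonneg (x : Site d) : 0 ≤ cubeGreen d L x :=
  tsum_nonneg fun n => convPow_cubeStep_nonneg n x

/-- `G_U = δ + Σ_m U^{*(m+1)}`. [folklore] -/
theorem cubeGreen_eq_delta0_add (hd : 3 ≤ d) (hL : 1 ≤ L) (w : Site d) :
    cubeGreen d L w = delta0 w + ∑' n, convPow (cubeStep d L) (n + 1) w :=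
  (summable_convPow_cubeStep hd hL w).tsum_eq_zero_add

/-- The renewal structure of `G_U` under the puncture decomposition:
`Σ_m U^{*(m+1)} = G_U * U = p₀ G_U + (1 - p₀) G_U * D`. [folklore] -/
theorem tsum_convPow_cubeStep_succ (hd : 3 ≤ d) (hL : 1 ≤ L) (w : Site d) :
    ∑' n, convPow (cubeStep d L) (n + 1) w =
      (((2 * L + 1 : ℝ)) ^ d)⁻¹ * cubeGreen d L w +
        (1 - (((2 * L + 1 : ℝ)) ^ d)⁻¹) * latticeConv (cubeGreen d L) (soStep d L) w := by
  have hd1 : 1 ≤ d := by omega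
  have h1 : ∀ n, convPow (cubeStep d L) (n + 1) w =
      (((2 * L + 1 : ℝ)) ^ d)⁻¹ * convPow (cubeStep d L) n w +
        (1 - (((2 * L + 1 : ℝ)) ^ d)⁻¹) *
          ∑ u ∈ (spreadOutGraph d L).neighborFinset w,
            convPow (cubeStep d L) n u * soStep d L (w - u) := fun n => by
    rw [← latticeConv_soStep_eq_sum_neighborFinset]
    exact latticeConv_cubeStep hd1 hL _ w
  have hs1 : Summable fun n => (((2 * L + 1 : ℝ)) ^ d)⁻¹ * convPow (cubeStep d L) n w :=
    (summable_convPow_cubeStep hd hL w).mul_left _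
  have hs2' : Summable fun n => ∑ u ∈ (spreadOutGraph d L).neighborFinset w,
      convPow (cubeStep d L) n u * soStep d L (w - u) :=
    summable_sum fun u _ => (summable_convPow_cubeStep hd hL u).mul_right _
  simp_rw [h1]
  rw [hs1.tsum_add (hs2'.mul_left _), tsum_mul_left, tsum_mul_left]
  congr 2
  rw [latticeConv_soStep_eq_sum_neighborFinset, Summable.tsum_finsetSum
    (fun u _ => (summable_convPow_cubeStep hd hL u).mul_right _)]
  exact Finset.sum_congr rfl fun u _ => tsum_mul_right

/-- **`G_U` is a supersolution of the renewal equation of the punctured walk**: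
`δ + G_U * D ≤ G_U` (indeed `G_U = δ/(1-p₀) + G_U * D`), for `d ≥ 3`, `L ≥ 1`. [folklore] -/
theorem cubeGreen_supersolution (hd : 3 ≤ d) (hL : 1 ≤ L) (w : Site d) :
    delta0 w + latticeConv (cubeGreen d L) (soStep d L) w ≤ cubeGreen d L w := by
  have hG := cubeGreen_eq_delta0_add hd hL w
  rw [tsum_convPow_cubeStep_succ hd hL w] at hG
  set p₀ : ℝ := (((2 * L + 1 : ℝ)) ^ d)⁻¹ with hp₀
  have h2L : (1 : ℝ) < 2 * L + 1 := by
    have : (1 : ℝ) ≤ L := by exact_mod_cast hL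
    linarith
  have hM1 : (1 : ℝ) < (2 * L + 1 : ℝ) ^ d := one_lt_pow₀ h2L (by omega)
  have hp0 : 0 ≤ p₀ := by positivity
  have hp1 : p₀ < 1 := inv_lt_one_of_one_lt₀ hM1
  have hδ : 0 ≤ delta0 w := delta0_nonneg w
  set G := cubeGreen d L w
  set C := latticeConv (cubeGreen d L) (soStep d L) w
  have hGC : 0 ≤ G - C := by nlinarith
  nlinarith

/-- **Minimality of `S_1`**: the partial sums `Σ_{n<N} D^{*n}` of the punctured walk's Green
function lie below every nonnegative supersolution, here `G_U`. [folklore] -/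
theorem sum_range_convPow_soStep_le_cubeGreen (hd : 3 ≤ d) (hL : 1 ≤ L) :
    ∀ (N : ℕ) (w : Site d), ∑ n ∈ range N, convPow (soStep d L) n w ≤ cubeGreen d L w
  | 0, w => by simpa using cubeGreen_nonneg (L := L) w
  | N + 1, w => by
    rw [Finset.sum_range_succ']
    calc ∑ n ∈ range N, convPow (soStep d L) (n + 1) w + convPow (soStep d L) 0 w
        = ∑ n ∈ range N, ∑ u ∈ (spreadOutGraph d L).neighborFinset w,
            convPow (soStep d L) n u * soStep d L (w - u) + delta0 w := by
          simp_rw [convPow_succ_eq_sum]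
          rfl
      _ = ∑ u ∈ (spreadOutGraph d L).neighborFinset w,
            (∑ n ∈ range N, convPow (soStep d L) n u) * soStep d L (w - u) + delta0 w := by
          rw [Finset.sum_comm]
          simp_rw [Finset.sum_mul]
      _ ≤ ∑ u ∈ (spreadOutGraph d L).neighborFinset w,
            cubeGreen d L u * soStep d L (w - u) + delta0 w :=
          add_le_add_left (Finset.sum_le_sum fun u _ => mul_le_mul_of_nonneg_right
            (sum_range_convPow_soStep_le_cubeGreen hd hL N u) (soStep_nonneg _)) _
      _ = latticeConv (cubeGreen d L) (soStep d L) w + delta0 w := by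
          rw [latticeConv_soStep_eq_sum_neighborFinset]
      _ ≤ cubeGreen d L w := by linarith [cubeGreen_supersolution hd hL w]

/-- **Removal of the puncture**: `S_1(x) = Σ_n D^{*n}(x) ≤ G_U(x)` for `d ≥ 3`, `L ≥ 1` (in fact
`S_1 = (1 - p₀) G_U`: the full-cube walk is the punctured walk with geometric holding times of
mean `1/(1-p₀)`; only the inequality is needed). [folklore] -/
theorem soGreen_one_le_cubeGreen (hd : 3 ≤ d) (hL : 1 ≤ L) (x : Site d) :
    soGreen d L 1 x ≤ cubeGreen d L x := by
  unfold soGreen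
  simp only [one_pow, one_mul]
  exact Real.tsum_le_of_sum_range_le (fun n => convPow_nonneg n x)
    fun N => sum_range_convPow_soStep_le_cubeGreen hd hL N x

/-- `G_U(x) ≤ δ_{0,x} + (20/L)^d Σ_{n≥0} (n+1)^{-d/2} exp(-(|x|²/(8L²))/(n+1))`. [folklore] -/
theorem cubeGreen_le (hd : 3 ≤ d) (hL : 1 ≤ L) (x : Site d)
    (hsum : Summable fun n : ℕ => (((n : ℝ) + 1) ^ ((d : ℝ) / 2))⁻¹ *
      Real.exp (-(euclidNorm x ^ 2 / (8 * L ^ 2) / ((n : ℝ) + 1)))) :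
    cubeGreen d L x ≤ delta0 x + (20 / (L : ℝ)) ^ d *
      ∑' n : ℕ, (((n : ℝ) + 1) ^ ((d : ℝ) / 2))⁻¹ *
        Real.exp (-(euclidNorm x ^ 2 / (8 * L ^ 2) / ((n : ℝ) + 1))) := by
  rw [cubeGreen_eq_delta0_add hd hL x, ← tsum_mul_left]
  refine add_le_add_right ?_ _
  exact ((summable_nat_add_iff 1).2 (summable_convPow_cubeStep hd hL x)).tsum_le_tsum
    (fun n => convPow_cubeStep_succ_le hL n x) (hsum.mul_left _)

/-! ## Part J. The summation lemma -/

/-- The telescoping inequality `(s-1)(t+1)^{-s} ≤ t^{1-s} - (t+1)^{1-s}` (`s > 1`, `t ≥ 1`), i.e.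
`∫_t^{t+1} u^{-s} du ≥ (t+1)^{-s}`, proved from `log(1-h) ≤ -h`. [folklore] -/
theorem rpow_inv_le_sub {s t : ℝ} (hs : 1 < s) (ht : 1 ≤ t) :
    (s - 1) * ((t + 1) ^ s)⁻¹ ≤ t ^ (1 - s) - (t + 1) ^ (1 - s) := by
  have ht0 : 0 < t := by linarith
  have ht1 : 0 < t + 1 := by linarith
  have hlog : Real.log (t / (t + 1)) ≤ -1 / (t + 1) := by
    have h := Real.log_le_sub_one_of_pos (show 0 < t / (t + 1) by positivity)
    have e : t / (t + 1) - 1 = -1 / (t + 1) := by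
      field_simp
      ring
    linarith
  have hkey : 1 + (s - 1) / (t + 1) ≤ (t / (t + 1)) ^ (1 - s) := by
    rw [Real.rpow_def_of_pos (by positivity)]
    have h2 : -1 / (t + 1) * (1 - s) ≤ Real.log (t / (t + 1)) * (1 - s) :=
      mul_le_mul_of_nonpos_right hlog (by linarith)
    have h3 : -1 / (t + 1) * (1 - s) = (s - 1) / (t + 1) := by ring
    calc 1 + (s - 1) / (t + 1) ≤ Real.exp ((s - 1) / (t + 1)) := by
          have := Real.add_one_le_exp ((s - 1) / (t + 1))
          linarith
      _ ≤ Real.exp (Real.log (t / (t + 1)) * (1 - s)) := Real.exp_le_exp.2 (by linarith)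
  have hsplit : t ^ (1 - s) = (t + 1) ^ (1 - s) * (t / (t + 1)) ^ (1 - s) := by
    rw [← Real.mul_rpow ht1.le (by positivity), mul_div_cancel₀ _ ht1.ne']
  have hts : (t + 1) ^ (1 - s) = (t + 1) * ((t + 1) ^ s)⁻¹ := by
    rw [Real.rpow_sub ht1, Real.rpow_one, div_eq_mul_inv]
  rw [hsplit, hts]
  have hX : 0 < (t + 1) * ((t + 1) ^ s)⁻¹ := by positivity
  have h4 := mul_le_mul_of_nonneg_left hkey hX.le
  have h5 : (t + 1) * ((t + 1) ^ s)⁻¹ * (1 + (s - 1) / (t + 1)) =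
      (t + 1) * ((t + 1) ^ s)⁻¹ + (s - 1) * ((t + 1) ^ s)⁻¹ := by
    field_simp
  linarith

/-- **The summation lemma**: for `s > 1` there is `C = C(s)` with
`Σ_{n ≥ 0} (n+1)^{-s} e^{-a/(n+1)} ≤ C (1 + a)^{1-s}` for all `a ≥ 0` — the sum is `O(1)` for
`a ≤ 1` and `O(a^{1-s})` for `a ≥ 1` (the terms with `n + 1 ≤ a` are each `O(a^{-s})` since
`yᵏe^{-y} ≤ k!`, and `Σ_{n ≥ a} (n+1)^{-s} = O(a^{1-s})`). [folklore] -/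
theorem tsum_rpow_inv_mul_exp_le {s : ℝ} (hs : 1 < s) :
    ∃ C : ℝ, 0 < C ∧ ∀ a : ℝ, 0 ≤ a →
      Summable (fun n : ℕ => (((n : ℝ) + 1) ^ s)⁻¹ * Real.exp (-(a / ((n : ℝ) + 1)))) ∧
      ∑' n : ℕ, (((n : ℝ) + 1) ^ s)⁻¹ * Real.exp (-(a / ((n : ℝ) + 1))) ≤
        C * (1 + a) ^ (1 - s) := by
  have hs1 : 0 < s - 1 := by linarith
  have hZs : Summable (fun n : ℕ => (((n : ℝ) + 1) ^ s)⁻¹) := by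
    have := (summable_nat_add_iff 1).2 (Real.summable_nat_rpow_inv.2 hs)
    simpa [Nat.cast_add, Nat.cast_one] using this
  set Z := ∑' n : ℕ, (((n : ℝ) + 1) ^ s)⁻¹ with hZ
  have hZ0 : 0 ≤ Z := tsum_nonneg fun n => by positivity
  set k := ⌈s⌉₊ with hk
  have hks : s ≤ k := Nat.le_ceil s
  set T : ℝ := (2 : ℝ) ^ (s - 1) / (s - 1) with hT
  have hT0 : 0 ≤ T := by positivity
  set C := (2 : ℝ) ^ (s - 1) * (Z + k.factorial + T) with hC
  refine ⟨C, by positivity, fun a ha => ?_⟩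
  set f : ℕ → ℝ := fun n => (((n : ℝ) + 1) ^ s)⁻¹ * Real.exp (-(a / ((n : ℝ) + 1))) with hf
  have hf0 : ∀ n, 0 ≤ f n := fun n => by positivity
  have hfle : ∀ n, f n ≤ (((n : ℝ) + 1) ^ s)⁻¹ := fun n => by
    refine mul_le_of_le_one_right (by positivity) (Real.exp_le_one_iff.2 ?_)
    rw [neg_nonpos]
    positivity
  have hfs : Summable f := Summable.of_nonneg_of_le hf0 hfle hZs
  refine ⟨hfs, ?_⟩
  have h2s : (2 : ℝ) ^ (s - 1) * (2 : ℝ) ^ (1 - s) = 1 := by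
    rw [← Real.rpow_add two_pos]
    norm_num
  rcases le_or_gt a 1 with ha1 | ha1
  · -- `a ≤ 1`: the sum is at most `Z ≤ 2^{s-1} Z (1+a)^{1-s}`
    have h1 : ∑' n, f n ≤ Z := hfs.tsum_le_tsum hfle hZs
    have h2 : (2 : ℝ) ^ (1 - s) ≤ (1 + a) ^ (1 - s) :=
      Real.rpow_le_rpow_of_nonpos (by linarith) (by linarith) (by linarith)
    calc ∑' n, f n ≤ Z := h1
      _ = (2 : ℝ) ^ (s - 1) * Z * (2 : ℝ) ^ (1 - s) := by
          rw [mul_comm _ Z, mul_assoc, h2s, mul_one]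
      _ ≤ (2 : ℝ) ^ (s - 1) * Z * (1 + a) ^ (1 - s) :=
          mul_le_mul_of_nonneg_left h2 (by positivity)
      _ ≤ C * (1 + a) ^ (1 - s) := by
          refine mul_le_mul_of_nonneg_right ?_ (by positivity)
          rw [hC]
          refine mul_le_mul_of_nonneg_left ?_ (by positivity)
          linarith [Nat.cast_nonneg (α := ℝ) k.factorial]
  · -- `a > 1`: split at `N = ⌊a⌋`
    have ha0 : 0 < a := by linarith
    set N := ⌊a⌋₊ with hN
    have hN1 : 1 ≤ N := Nat.le_floor (by simpa using ha1.le)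
    have hN1' : (1 : ℝ) ≤ N := by exact_mod_cast hN1
    have hNa : (N : ℝ) ≤ a := Nat.floor_le ha
    have haN : a < N + 1 := Nat.lt_floor_add_one a
    rw [← hfs.sum_add_tsum_nat_add N]
    -- head: `n < N`, so `n + 1 ≤ a`; each term is at most `k! a^{-s}`
    have hhead : ∑ n ∈ range N, f n ≤ k.factorial * a ^ (1 - s) := by
      have hterm : ∀ n ∈ range N, f n ≤ k.factorial * (a ^ s)⁻¹ := by
        intro n hn
        have hn1 : (n : ℝ) + 1 ≤ a := by
          have h := Finset.mem_range.1 hn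
          have : (n : ℝ) + 1 ≤ N := by exact_mod_cast h
          linarith
        set y := a / ((n : ℝ) + 1) with hy
        have hy1 : 1 ≤ y := by
          rw [hy, le_div_iff₀ (by positivity)]
          linarith
        have hfn : f n = (a ^ s)⁻¹ * (y ^ s * Real.exp (-y)) := by
          simp only [hf, hy]
          rw [Real.div_rpow ha (by positivity)]
          field_simp
        have h1 : y ^ s ≤ y ^ (k : ℝ) := Real.rpow_le_rpow_of_exponent_le hy1 hks
        have h2 : y ^ (k : ℝ) * Real.exp (-y) ≤ k.factorial := by
          rw [Real.rpow_natCast, Real.exp_neg, ← div_eq_mul_inv, div_le_iff₀ (Real.exp_pos _)]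
          have := Real.pow_div_factorial_le_exp y (by linarith) k
          rw [div_le_iff₀ (by positivity)] at this
          linarith
        rw [hfn]
        calc (a ^ s)⁻¹ * (y ^ s * Real.exp (-y)) ≤ (a ^ s)⁻¹ * (y ^ (k : ℝ) * Real.exp (-y)) := by
              gcongr
          _ ≤ (a ^ s)⁻¹ * k.factorial := mul_le_mul_of_nonneg_left h2 (by positivity)
          _ = k.factorial * (a ^ s)⁻¹ := mul_comm _ _
      calc ∑ n ∈ range N, f n ≤ ∑ _n ∈ range N, (k.factorial : ℝ) * (a ^ s)⁻¹ :=
            Finset.sum_le_sum hterm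
        _ = N * (k.factorial * (a ^ s)⁻¹) := by
            rw [Finset.sum_const, Finset.card_range, nsmul_eq_mul]
        _ ≤ a * (k.factorial * (a ^ s)⁻¹) := mul_le_mul_of_nonneg_right hNa (by positivity)
        _ = k.factorial * a ^ (1 - s) := by
            rw [Real.rpow_sub ha0, Real.rpow_one]
            ring
    -- tail: telescoping from `N`
    set g : ℕ → ℝ := fun n => ((n : ℝ) + N) ^ (1 - s) with hg
    have hg0 : ∀ n, 0 ≤ g n := fun n => by positivity
    have hgf : ∀ n : ℕ, f (n + N) ≤ (1 / (s - 1)) * (g n - g (n + 1)) := by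
      intro n
      refine (hfle (n + N)).trans ?_
      have h := rpow_inv_le_sub hs (t := (n : ℝ) + N) (by linarith [Nat.cast_nonneg (α := ℝ) n])
      have e1 : g (n + 1) = ((n : ℝ) + N + 1) ^ (1 - s) := by
        simp only [hg]
        push_cast
        ring_nf
      rw [e1, Nat.cast_add]
      calc (((n : ℝ) + N + 1) ^ s)⁻¹ = (1 / (s - 1)) * ((s - 1) * (((n : ℝ) + N + 1) ^ s)⁻¹) := by
            field_simp
        _ ≤ (1 / (s - 1)) * (g n - ((n : ℝ) + N + 1) ^ (1 - s)) :=
            mul_le_mul_of_nonneg_left h (by positivity)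
    have hpart : ∀ M : ℕ, ∑ n ∈ range M, f (n + N) ≤ (1 / (s - 1)) * (N : ℝ) ^ (1 - s) := by
      intro M
      calc ∑ n ∈ range M, f (n + N) ≤ ∑ n ∈ range M, (1 / (s - 1)) * (g n - g (n + 1)) :=
            Finset.sum_le_sum fun n _ => hgf n
        _ = (1 / (s - 1)) * (g 0 - g M) := by rw [← Finset.mul_sum, Finset.sum_range_sub']
        _ ≤ (1 / (s - 1)) * g 0 := by
            refine mul_le_mul_of_nonneg_left ?_ (by positivity)
            linarith [hg0 M]
        _ = (1 / (s - 1)) * (N : ℝ) ^ (1 - s) := by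
            simp only [hg, Nat.cast_zero, zero_add]
    have htail : ∑' n, f (n + N) ≤ T * a ^ (1 - s) := by
      have ht1 := Real.tsum_le_of_sum_range_le (fun n => hf0 (n + N)) hpart
      have hN2 : (N : ℝ) ^ (1 - s) ≤ (a / 2) ^ (1 - s) :=
        Real.rpow_le_rpow_of_nonpos (by positivity) (by linarith) (by linarith)
      have ha2 : (a / 2) ^ (1 - s) = (2 : ℝ) ^ (s - 1) * a ^ (1 - s) := by
        rw [Real.div_rpow ha (by norm_num), div_eq_mul_inv, ← Real.rpow_neg (by norm_num), neg_sub,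
          mul_comm]
      calc ∑' n, f (n + N) ≤ (1 / (s - 1)) * (N : ℝ) ^ (1 - s) := ht1
        _ ≤ (1 / (s - 1)) * ((2 : ℝ) ^ (s - 1) * a ^ (1 - s)) := by
            rw [← ha2]
            exact mul_le_mul_of_nonneg_left hN2 (by positivity)
        _ = T * a ^ (1 - s) := by
            rw [hT]
            ring
    -- combine
    have h3 : a ^ (1 - s) ≤ (2 : ℝ) ^ (s - 1) * (1 + a) ^ (1 - s) := by
      calc a ^ (1 - s) ≤ ((1 + a) / 2) ^ (1 - s) :=
            Real.rpow_le_rpow_of_nonpos (by positivity) (by linarith) (by linarith)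
        _ = (2 : ℝ) ^ (s - 1) * (1 + a) ^ (1 - s) := by
            rw [Real.div_rpow (by linarith) (by norm_num), div_eq_mul_inv,
              ← Real.rpow_neg (by norm_num), neg_sub, mul_comm]
    have hX : 0 ≤ (1 + a) ^ (1 - s) := by positivity
    calc ∑ n ∈ range N, f n + ∑' n, f (n + N)
        ≤ k.factorial * a ^ (1 - s) + T * a ^ (1 - s) := add_le_add hhead htail
      _ = (k.factorial + T) * a ^ (1 - s) := by ring
      _ ≤ (k.factorial + T) * ((2 : ℝ) ^ (s - 1) * (1 + a) ^ (1 - s)) :=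
          mul_le_mul_of_nonneg_left h3 (by positivity)
      _ = (2 : ℝ) ^ (s - 1) * (k.factorial + T) * (1 + a) ^ (1 - s) := by ring
      _ ≤ C * (1 + a) ^ (1 - s) := by
          refine mul_le_mul_of_nonneg_right ?_ hX
          rw [hC]
          refine mul_le_mul_of_nonneg_left ?_ (by positivity)
          linarith

/-! ## Part K. Assembly: Proposition 1.2, (1.10) -/

/-- The final algebra: `(20/L)^d (t²/(8L²))^{1-d/2} = 20^d 8^{d/2-1} L^{-2} t^{-(d-2)}` for
`L, t > 0`. [folklore] -/
theorem prefactor_identity (d : ℕ) {L t : ℝ} (hL : 0 < L) (ht : 0 < t) :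
    (20 / L) ^ d * (t ^ 2 / (8 * L ^ 2)) ^ (1 - (d : ℝ) / 2) =
      (20 : ℝ) ^ d * (8 : ℝ) ^ ((d : ℝ) / 2 - 1) * L ^ (-(2 : ℝ)) * t ^ (-((d : ℝ) - 2)) := by
  have e1 : (t ^ 2 / (8 * L ^ 2)) ^ (1 - (d : ℝ) / 2) =
      t ^ (-((d : ℝ) - 2)) * ((8 : ℝ) ^ ((d : ℝ) / 2 - 1) * L ^ ((d : ℝ) - 2)) := by
    rw [Real.div_rpow (by positivity) (by positivity), Real.mul_rpow (by norm_num) (by positivity),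
      div_eq_mul_inv, mul_inv, ← Real.rpow_neg (by norm_num), ← Real.rpow_neg (by positivity),
      neg_sub, show (t ^ 2 : ℝ) = t ^ ((2 : ℕ) : ℝ) from (Real.rpow_natCast t 2).symm,
      show (L ^ 2 : ℝ) = L ^ ((2 : ℕ) : ℝ) from (Real.rpow_natCast L 2).symm,
      ← Real.rpow_mul ht.le, ← Real.rpow_mul hL.le]
    congr 2
    · push_cast
      ring
    · congr 1
      push_cast
      ring
  have e2 : (20 / L) ^ d = (20 : ℝ) ^ d * L ^ (-(d : ℝ)) := by
    rw [div_pow, Real.rpow_neg hL.le, Real.rpow_natCast, div_eq_mul_inv]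
  have e3 : L ^ (-(d : ℝ)) * L ^ ((d : ℝ) - 2) = L ^ (-(2 : ℝ)) := by
    rw [← Real.rpow_add hL]
    congr 1
    ring
  rw [e1, e2]
  calc (20 : ℝ) ^ d * L ^ (-(d : ℝ)) *
        (t ^ (-((d : ℝ) - 2)) * ((8 : ℝ) ^ ((d : ℝ) / 2 - 1) * L ^ ((d : ℝ) - 2)))
      = (20 : ℝ) ^ d * (8 : ℝ) ^ ((d : ℝ) / 2 - 1) * (L ^ (-(d : ℝ)) * L ^ ((d : ℝ) - 2)) *
          t ^ (-((d : ℝ) - 2)) := by ring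
    _ = _ := by rw [e3]

/-- **Liu–Slade 2026, Proposition 1.2, (1.10), PROVED** — the named fact
`LiuSlade2026_prop12_greenBound` of `LaceExpansionIsingDeconvolution.lean` discharged: for
`d > 2` and `ε > 0` there are `K_S > 0` and `L₀` (here `K_S = 20^d C_{d/2} 8^{d/2-1}`, independent
of `ε`, and `L₀ = 1`) such that for all `L ≥ L₀` and `x ∈ ℤ^d`,
`S_1(x) ≤ δ_{0,x} + K_S L^{-(2-ε)} ⟦x⟧^{-(d-2)}`; via the stronger `ε = 0` bound obtained from the
supersolution comparison `S_1 ≤ G_U`, the tensorised `L`-uniform Gaussian bound on `U^{*n}` and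
the summation lemma. [cite: LiuSlade2026, Proposition 1.2, (1.10)] -/
theorem LiuSlade2026_prop12_greenBound_holds : LiuSlade2026_prop12_greenBound := by
  intro d hd ε hε
  have hd3 : 3 ≤ d := hd
  have hd2 : 1 < (d : ℝ) / 2 := by
    have : (3 : ℝ) ≤ d := by exact_mod_cast hd3
    linarith
  obtain ⟨C, hC, hser⟩ := tsum_rpow_inv_mul_exp_le hd2
  refine ⟨(20 : ℝ) ^ d * C * (8 : ℝ) ^ ((d : ℝ) / 2 - 1), by positivity, 1, fun L hL x => ?_⟩
  have hL' : (1 : ℝ) ≤ L := by exact_mod_cast hL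
  have hL0 : (0 : ℝ) < L := by linarith
  set t := jnorm x with ht
  have ht1 : 1 ≤ t := one_le_jnorm x
  have ht0 : 0 < t := jnorm_pos x
  set a : ℝ := euclidNorm x ^ 2 / (8 * L ^ 2) with ha
  have ha0 : 0 ≤ a := by positivity
  obtain ⟨hsum, hbound⟩ := hser a ha0
  -- `t² ≤ 8L²(1 + a) = 8L² + |x|²`, so `(1+a)^{1-d/2} ≤ (t²/(8L²))^{1-d/2}`
  have hta : t ^ 2 / (8 * L ^ 2) ≤ 1 + a := by
    rw [div_le_iff₀ (by positivity), ha, add_mul, one_mul, div_mul_cancel₀ _ (by positivity)]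
    have he : 0 ≤ euclidNorm x := euclidNorm_nonneg x
    rcases le_total (euclidNorm x) 1 with h | h
    · have e : t = 1 := by rw [ht, jnorm]; exact max_eq_right h
      rw [e]
      nlinarith
    · have e : t = euclidNorm x := by rw [ht, jnorm]; exact max_eq_left h
      rw [e]
      nlinarith
  have hanti : (1 + a) ^ (1 - (d : ℝ) / 2) ≤ (t ^ 2 / (8 * L ^ 2)) ^ (1 - (d : ℝ) / 2) :=
    Real.rpow_le_rpow_of_nonpos (by positivity) hta (by linarith)
  have hLe : (L : ℝ) ^ (-(2 : ℝ)) ≤ (L : ℝ) ^ (-(2 - ε)) :=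
    Real.rpow_le_rpow_of_exponent_le hL' (by linarith)
  have hid := prefactor_identity d hL0 ht0
  calc soGreen d L 1 x ≤ cubeGreen d L x := soGreen_one_le_cubeGreen hd3 hL x
    _ ≤ delta0 x + (20 / (L : ℝ)) ^ d * ∑' n : ℕ, (((n : ℝ) + 1) ^ ((d : ℝ) / 2))⁻¹ *
          Real.exp (-(euclidNorm x ^ 2 / (8 * L ^ 2) / ((n : ℝ) + 1))) :=
        cubeGreen_le hd3 hL x hsum
    _ ≤ delta0 x + (20 / (L : ℝ)) ^ d * (C * (1 + a) ^ (1 - (d : ℝ) / 2)) :=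
        add_le_add_right (mul_le_mul_of_nonneg_left hbound (by positivity)) _
    _ ≤ delta0 x + (20 / (L : ℝ)) ^ d * (C * (t ^ 2 / (8 * L ^ 2)) ^ (1 - (d : ℝ) / 2)) :=
        add_le_add_right (mul_le_mul_of_nonneg_left
          (mul_le_mul_of_nonneg_left hanti hC.le) (by positivity)) _
    _ = delta0 x + (20 : ℝ) ^ d * C * (8 : ℝ) ^ ((d : ℝ) / 2 - 1) * (L : ℝ) ^ (-(2 : ℝ)) *
          t ^ (-((d : ℝ) - 2)) := by
        calc _ = delta0 x +
              C * ((20 / (L : ℝ)) ^ d * (t ^ 2 / (8 * L ^ 2)) ^ (1 - (d : ℝ) / 2)) := by ring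
          _ = _ := by
              rw [hid]
              ring
    _ ≤ delta0 x + (20 : ℝ) ^ d * C * (8 : ℝ) ^ ((d : ℝ) / 2 - 1) * (L : ℝ) ^ (-(2 - ε)) *
          t ^ (-((d : ℝ) - 2)) := by
        gcongr

end Literature.Barriers.CriticalPhenomena.SpreadOutIsing
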